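import Literature.Geometry.Riemannian.ToppingEntropyIntegrand
import Literature.Geometry.Riemannian.RicciFlowScalarCurvatureEvolution
import Literature.Geometry.Lorentzian.CoordConjugateHeat
import Literature.Geometry.Lorentzian.EndChartIntegral
import HarnessLib

/-!
# Topping's Prop. 8.2.6 on a manifold: `□* v ≤ 0` along positive conjugate heat solutions of a
# Ricci flow, and Perelman's no local collapsing theorem from the conjugate heat flow alone

`ToppingEntropyIntegrand.lean` reduces the named fact `perelman_noLocalCollapsing`
(`CanonicalNeighbourhoods.lean`; Perelman 2002, §4, Thm. 4.1) to two inputs on closed manifolds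
modelled on `ℝ^m` carrying a Ricci flow: (CH) backward solvability of the conjugate heat
equation `□* u = 0`, and (P) the pointwise inequality `□* v ≤ 0` of **Topping 2006, Prop. 8.2.6**
(`□* v = −2τ|Ric + Hess f − g/2τ|² u`) for Topping's `v = [τ(2Δf − |∇f|² + R) + f − n] u`
(`entropyIntegrand`). `CoordConjugateHeat.lean` PROVES Prop. 8.2.6 for the components of a
coordinate Ricci flow (`MetricCoord.IsMetricFamilyOn.conjHeat_entropyDensity_nonneg`:
`∂ₜv + Δv − Rv ≥ 0` in coordinates). This file transports that identity to the manifold through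
the chart at a point — the flow read in the chart at `x` is a coordinate Ricci flow
(`IsRicciFlow.isMetricFamilyOn_chartRep`, `IsRicciFlow.tDeriv_chartRep_eq`), a conjugate heat
solution reads as a coordinate conjugate heat solution, and `Δ`, `|∇·|²`, `R` read as `lapAt`,
`gradSqAt`, `scalAt` (O'Neill 1983, Ch. 3, Prop. 3.59: local isometries preserve the metric
invariants) — and so DISCHARGES (P):

* `OpensChart.gradSq_eq_gradSqAt`, `gradSq_chartPullback_eq`, `lapAt_chartRep_eq`,
  `gradSqAt_chartRep_eq`, `chartRep_posDef` — the chart dictionary for `|∇F|²`, `ΔF` and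
  positivity;
* `IsRicciFlow.conjugateHeatOp_entropyIntegrand_nonpos` — **Topping 2006, Prop. 8.2.6 (sign) on a
  manifold**: for a Ricci flow of Riemannian metrics on `[0, T']`, `T' > 0`, on ANY manifold with
  boundaryless finite-dimensional model `E`, `n = dim E`, every positive conjugate heat solution
  `u` on `M × [0, T']` and `τ₀ > T'`: `□* v ≤ 0` on `M × [0, T']`, `v = entropyIntegrand g cov u n τ₀`;
* `perelman_noLocalCollapsing_of_conjugateHeat_existence` — **the named fact
  `perelman_noLocalCollapsing` follows from (CH) alone**: backward solvability of `□* u = 0` with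
  smooth positive final data on closed manifolds modelled on `ℝ^m` carrying a Ricci flow
  (Topping 2006, Rem. 8.2.5 / §6.4; standard linear parabolic theory, absent from Mathlib).
  NOT a discharge of the named fact.

Everything is proved; no definition, no named fact.

## References

* P. Topping, *Lectures on the Ricci flow*, LMS Lecture Note Series 325, CUP 2006, §6.4,
  (6.4.8); §8.2, (8.2.3), Rem. 8.2.5, Prop. 8.2.6, Rem. 8.2.7; §8.3, Thm. 8.3.1. [Topping2006]
* G. Perelman, *The entropy formula for the Ricci flow and its geometric applications*,
  arXiv:math/0211159 (2002), §3.1, (3.4); §4, Thm. 4.1; §9, Prop. 9.1. [Perelman2002]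
* B. O'Neill, *Semi-Riemannian geometry with applications to relativity*, Academic Press 1983,
  Ch. 3, Prop. 3.59 and pp. 90–91. [ONeill1983]
-/

noncomputable section

open Set Function Filter Manifold Bundle MeasureTheory Module
open scoped Manifold ContDiff Topology

namespace Literature.Geometry.Riemannian

open Lorentzian Lorentzian.PseudoRiemannianMetric

universe u v w

/-! ### The chart dictionary for `|∇F|²` and `ΔF` -/

section ChartBridge

variable {E : Type*} [NormedAddCommGroup E] [NormedSpace ℝ E] [FiniteDimensional ℝ E]
  [CompleteSpace E] {H : Type*} [TopologicalSpace H] {I : ModelWithCorners ℝ E H} [I.Boundaryless]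
  {M : Type*} [TopologicalSpace M] [ChartedSpace H M] [IsManifold I ∞ M]

omit [CompleteSpace E] in
/-- **`|∇f|²` of a metric on an open subset of `E` is `gradSqAt` of its components** (for a
function with a differentiable representative): `g⁻¹(df, df)(x) = DΦ_x(♯ DΦ_x)`
(`OpensChart.mvfderiv_eq`, `OpensChart.sharp_eq_sharpAt`). [cite: ONeill1983, Ch. 3, p. 85] -/
theorem _root_.Literature.Geometry.Lorentzian.OpensChart.gradSq_eq_gradSqAt
    {U : TopologicalSpace.Opens E}
    {g : PseudoRiemannianMetric 𝓘(ℝ, E) ∞ E (TangentSpace 𝓘(ℝ, E) : U → Type _)}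
    {G : E → E →L[ℝ] E →L[ℝ] ℝ} (hG : ∀ y : U, g.val y = G y) (x : U) {f : U → ℝ} {Φ : E → ℝ}
    (hf : ∀ y : U, f y = Φ y) (hΦ : DifferentiableAt ℝ Φ x) :
    g.gradSq f x = MetricCoord.gradSqAt G Φ x := by
  have hd : (mvfderiv 𝓘(ℝ, E) f x : TangentSpace 𝓘(ℝ, E) x →L[ℝ] ℝ) = fderiv ℝ Φ x := by
    ext v
    exact OpensChart.mvfderiv_eq x f Φ hf hΦ v
  rw [gradSq_eq, hd, OpensChart.sharp_eq_sharpAt hG x, MetricCoord.gradSqAt_apply]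
  rfl

omit [CompleteSpace E] in
/-- **`|∇F|²` read in the chart**: `|∇(F ∘ Φ)|²_{Φ^*g}(u) = |∇F|²_g(Φ u)` for the metric read in the
chart at `x₀` (`chartPullback`, `Φ = chartInv I x₀`) and `F` differentiable at `Φ u`
(`innerDual_mvfderiv_comp`). [cite: ONeill1983, Ch. 3, Prop. 3.59] -/
theorem gradSq_chartPullback_eq (g : PseudoRiemannianMetric I ∞ E (TangentSpace I : M → Type _))
    (x₀ : M) (u : chartTarget I x₀) {F : M → ℝ}
    (hF : MDifferentiableAt I 𝓘(ℝ, ℝ) F (chartInv I x₀ u)) :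
    (chartPullback I g x₀).gradSq (F ∘ chartInv I x₀) u = g.gradSq F (chartInv I x₀ u) := by
  unfold PseudoRiemannianMetric.gradSq
  exact g.innerDual_mvfderiv_comp contMDiff_pullbackBilin_holds (contMDiff_chartInv x₀)
    (injective_mfderiv_chartInv x₀) rfl u hF hF

/-- **`ΔF` read in the chart of a family**: for the chart components `chartRep I g x₀ s` of the
metric `g s` and a representative `Fc` of `F` on the chart target (`F (Φ y) = Fc y`), `C²` at `u`,
with `F` of class `C²` at `Φ u`: `lapAt (G s) Fc u = Δ_{g s} F (Φ u)` (`dalembertian_comap`,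
`OpensChart.dalembertian_eq_lapAt`). [cite: ONeill1983, Ch. 3, Prop. 3.59] -/
theorem lapAt_chartRep_eq (g : ℝ → PseudoRiemannianMetric I ∞ E (TangentSpace I : M → Type _))
    (x₀ : M) (s : ℝ) (u : chartTarget I x₀) {F : M → ℝ} {Fc : E → ℝ}
    (hrep : ∀ y : chartTarget I x₀, F (chartInv I x₀ y) = Fc y)
    (hF : ContMDiffAt I 𝓘(ℝ, ℝ) 2 F (chartInv I x₀ u)) (hFc : ContDiffAt ℝ 2 Fc u) :
    MetricCoord.lapAt (chartRep I g x₀ s) Fc u = (g s).laplaceBeltrami F (chartInv I x₀ u) := by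
  haveI := (g s).hasLeviCivita
  haveI := (chartPullback I (g s) x₀).hasLeviCivita
  have hG := val_chartPullback_eq_chartRep g x₀ s
  rw [← Lorentzian.OpensChart.dalembertian_eq_lapAt hG u (f := F ∘ chartInv I x₀) hrep hFc,
    (g s).dalembertian_comap contMDiff_pullbackBilin_holds (contMDiff_chartInv x₀)
      (injective_mfderiv_chartInv x₀) rfl hF,
    laplaceBeltrami_eq_dalembertian]

omit [CompleteSpace E] in
/-- **`|∇F|²` read in the chart of a family**: `gradSqAt (G s) Fc u = |∇F|²_{g s}(Φ u)` for a
representative `Fc` of `F` differentiable at `u`, `F` differentiable at `Φ u`.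
[cite: ONeill1983, Ch. 3, Prop. 3.59] -/
theorem gradSqAt_chartRep_eq (g : ℝ → PseudoRiemannianMetric I ∞ E (TangentSpace I : M → Type _))
    (x₀ : M) (s : ℝ) (u : chartTarget I x₀) {F : M → ℝ} {Fc : E → ℝ}
    (hrep : ∀ y : chartTarget I x₀, F (chartInv I x₀ y) = Fc y)
    (hF : MDifferentiableAt I 𝓘(ℝ, ℝ) F (chartInv I x₀ u)) (hFc : DifferentiableAt ℝ Fc u) :
    MetricCoord.gradSqAt (chartRep I g x₀ s) Fc u = (g s).gradSq F (chartInv I x₀ u) := by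
  have hG := val_chartPullback_eq_chartRep g x₀ s
  rw [← Lorentzian.OpensChart.gradSq_eq_gradSqAt hG u (f := F ∘ chartInv I x₀) hrep hFc,
    gradSq_chartPullback_eq (g s) x₀ u hF]

omit [CompleteSpace E] in
/-- The chart components of a Riemannian metric are positive definite on the chart target
(`chartPullback_pos`: `dΦ` is injective). [folklore] -/
theorem chartRep_posDef (g : ℝ → PseudoRiemannianMetric I ∞ E (TangentSpace I : M → Type _))
    (x₀ : M) (s : ℝ) (hR : (g s).IsRiemannian) (u : chartTarget I x₀) (v : E) (hv : v ≠ 0) :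
    0 < chartRep I g x₀ s u v v := by
  rw [chartRep_apply]
  exact chartPullback_pos (g s) x₀ u (fun w hw ↦ hR _ w hw) v hv

end ChartBridge

/-! ### Topping's Prop. 8.2.6 on a manifold -/

section Pointwise

variable {E : Type*} [NormedAddCommGroup E] [NormedSpace ℝ E] [FiniteDimensional ℝ E]
  [CompleteSpace E] {H : Type*} [TopologicalSpace H] {I : ModelWithCorners ℝ E H} [I.Boundaryless]
  {M : Type*} [TopologicalSpace M] [ChartedSpace H M] [IsManifold I ∞ M]
  {g : ℝ → PseudoRiemannianMetric I ∞ E (TangentSpace I : M → Type _)}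
  {cov : ℝ → CovariantDerivative I E (TangentSpace I : M → Type _)}

/-- **Topping 2006, Prop. 8.2.6 (the sign of `□* v`) on a manifold.** Let `(g, cov)` be a Ricci
flow of Riemannian metrics on `[0, T']`, `T' > 0`, on a manifold with boundaryless model `E` of
dimension `n`, let `u > 0` be a smooth solution of the conjugate heat equation `□* u = 0` on
`M × [0, T']` (`IsConjugateHeatSolutionOn`), and let `τ₀ > T'` (`τ = τ₀ − t > 0`). Then Topping's
`v = [τ(2Δf − |∇f|² + R) + f − n] u`, `f = −log u − (n/2) log(4πτ)` (`entropyIntegrand`), satisfies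
`□* v ≤ 0` at every `(x, t) ∈ M × [0, T']` — in print `□* v = −2τ|Ric + Hess f − g/2τ|² u`. Proof:
read the flow, `u` and `v` in the chart at `x` (`IsRicciFlow.isMetricFamilyOn_chartRep`,
`tDeriv_chartRep_eq`, `lapAt_chartRep_eq`, `gradSqAt_chartRep_eq`, `scalAt_chartRep_eq`) and apply
the coordinate identity `MetricCoord.IsMetricFamilyOn.conjHeat_entropyDensity_nonneg`
(`CoordConjugateHeat.lean`). No compactness is needed.
[cite: Topping2006, §8.2, Prop. 8.2.6] [cite: Perelman2002, §9, Prop. 9.1] -/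
theorem IsRicciFlow.conjugateHeatOp_entropyIntegrand_nonpos {T' : ℝ} (hT' : 0 < T')
    (h : IsRicciFlow g cov (Icc 0 T')) (hR : ∀ t ∈ Icc 0 T', (g t).IsRiemannian)
    {u : ℝ → M → ℝ} (hpos : ∀ t ∈ Icc 0 T', ∀ x, 0 < u t x)
    (hsol : IsConjugateHeatSolutionOn g cov (Icc 0 T') u) {n : ℕ} (hn : Module.finrank ℝ E = n)
    {τ₀ : ℝ} (hτ₀ : T' < τ₀) {t : ℝ} (ht : t ∈ Icc 0 T') (x : M) :
    conjugateHeatOp g cov (Icc 0 T') (entropyIntegrand g cov u n τ₀) t x ≤ 0 := by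
  have h2 : (2 : ℕ∞ω) ≤ ∞ := WithTop.coe_le_coe.mpr le_top
  have hu := hsol.1
  have hpde := hsol.2
  have hVopen : IsOpen (extChartAt I x).target := isOpen_extChartAt_target x
  -- (1) the flow read in the chart at `x` is a coordinate Ricci flow
  have hfam := h.isMetricFamilyOn_chartRep hT' x
  have hfl : ∀ s ∈ Icc 0 T', ∀ y ∈ (extChartAt I x).target,
      MetricCoord.tDeriv (chartRep I g x) (Icc 0 T') s y =
        (-2 : ℝ) • MetricCoord.ricAt (chartRep I g x s) y := fun s hs y hy ↦
    h.tDeriv_chartRep_eq hT' x hs hy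
  -- (2) the solution read in the chart
  set uc : ℝ → E → ℝ := fun s y ↦ u s ((extChartAt I x).symm y) with huc
  have huc_smooth : ContDiffOn ℝ ∞ (fun q : E × ℝ ↦ uc q.2 q.1)
      ((extChartAt I x).target ×ˢ Icc 0 T') :=
    contDiffOn_chart_of_contMDiffOn_source_prod (k := (⊤ : ℕ∞)) (w := u) x
      (hu.mono (prod_mono (subset_univ _) Subset.rfl))
  have huc_pos : ∀ s ∈ Icc 0 T', ∀ y ∈ (extChartAt I x).target, 0 < uc s y :=
    fun s hs y _ ↦ hpos s hs _
  have hc : ∀ s ∈ Icc 0 T', s < τ₀ := fun s hs ↦ hs.2.trans_lt hτ₀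
  have hslice : ∀ s ∈ Icc 0 T', ContMDiff I 𝓘(ℝ, ℝ) ∞ (u s) := fun s hs ↦
    contMDiff_slice_of_contMDiffOn hu hs
  have huc2 : ∀ s ∈ Icc 0 T', ∀ y : chartTarget I x, ContDiffAt ℝ 2 (uc s) y := fun s hs y ↦
    (((MetricCoord.contDiffOn_of_family huc_smooth hs).contDiffAt (hVopen.mem_nhds y.2)).of_le h2)
  have hurep : ∀ s, ∀ y : chartTarget I x, u s (chartInv I x y) = uc s y := fun s y ↦ rfl
  -- (3) the conjugate heat equation read in the chart
  have hueq : ∀ s ∈ Icc 0 T', ∀ y ∈ (extChartAt I x).target,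
      MetricCoord.tDerivFun uc (Icc 0 T') s y =
        -MetricCoord.lapAt (chartRep I g x s) (uc s) y +
          MetricCoord.scalAt (chartRep I g x s) y * uc s y := by
    intro s hs y hy
    have hΔ := lapAt_chartRep_eq g x s ⟨y, hy⟩ (hurep s) (((hslice s hs) _).of_le h2)
      (huc2 s hs ⟨y, hy⟩)
    have hRs := h.scalAt_chartRep_eq x hs ⟨y, hy⟩
    rw [MetricCoord.tDerivFun, hΔ, hRs]
    exact hpde s hs _
  -- (4) positivity of the components at `(t, φ x)`
  have hy₀ : extChartAt I x x ∈ (extChartAt I x).target := mem_extChartAt_target x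
  have hposdef : ∀ v : E, v ≠ 0 → 0 < chartRep I g x t (extChartAt I x x) v v := fun v hv ↦
    chartRep_posDef g x t (hR t ht) ⟨_, hy₀⟩ v hv
  -- (5) Prop. 8.2.6 for the components
  have key := hfam.conjHeat_entropyDensity_nonneg hfl huc_smooth huc_pos hc hy₀ ht (hueq t ht)
    hposdef
  -- (6) the potential and Topping's `v` read in the chart
  have hlog : ContDiffOn ℝ ∞ (fun s : ℝ ↦ (n : ℝ) / 2 * Real.log (4 * Real.pi * (τ₀ - s)))
      (Icc 0 T') := by
    intro s hs
    have hpos' : 4 * Real.pi * (τ₀ - s) ≠ 0 := by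
      have : 0 < τ₀ - s := by linarith [hs.2]
      positivity
    exact (contDiffAt_const.mul ((Real.contDiffAt_log.2 hpos').comp s
      (contDiffAt_const.mul (contDiffAt_const.sub contDiffAt_id)))).contDiffWithinAt
  have hf : ContMDiffOn (I.prod 𝓘(ℝ, ℝ)) 𝓘(ℝ, ℝ) ∞
      (fun p : M × ℝ ↦ entropyPotential u n τ₀ p.2 p.1) (univ ×ˢ Icc 0 T') :=
    (contMDiffOn_neg_log_prod hpos hu).sub (contMDiffOn_of_time hlog)
  have hfc : ContDiffOn ℝ ∞ (fun q : E × ℝ ↦ MetricCoord.conjHeatPotential uc τ₀ q.2 q.1)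
      ((extChartAt I x).target ×ˢ Icc 0 T') :=
    MetricCoord.IsMetricFamilyOn.contDiffOn_conjHeatPotential huc_smooth huc_pos hc
  have hfrep : ∀ s, ∀ y : chartTarget I x,
      entropyPotential u n τ₀ s (chartInv I x y) = MetricCoord.conjHeatPotential uc τ₀ s y := by
    intro s y
    rw [entropyPotential_apply, MetricCoord.conjHeatPotential_apply, hn]
    rfl
  have hf2 : ∀ s ∈ Icc 0 T', ∀ y : chartTarget I x,
      ContMDiffAt I 𝓘(ℝ, ℝ) 2 (entropyPotential u n τ₀ s) (chartInv I x y) := fun s hs y ↦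
    ((contMDiff_slice_of_contMDiffOn hf hs) _).of_le h2
  have hfc2 : ∀ s ∈ Icc 0 T', ∀ y : chartTarget I x,
      ContDiffAt ℝ 2 (MetricCoord.conjHeatPotential uc τ₀ s) y := fun s hs y ↦
    (((MetricCoord.contDiffOn_of_family hfc hs).contDiffAt (hVopen.mem_nhds y.2)).of_le h2)
  have hwrep : ∀ s ∈ Icc 0 T', ∀ y : chartTarget I x,
      entropyIntegrand g cov u n τ₀ s (chartInv I x y) =
        MetricCoord.conjHeatEntropyDensity (chartRep I g x) uc τ₀ s y := by
    intro s hs y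
    have hΔ := lapAt_chartRep_eq g x s y (hfrep s) (hf2 s hs y) (hfc2 s hs y)
    have hgr := gradSqAt_chartRep_eq g x s y (hfrep s)
      ((hf2 s hs y).mdifferentiableAt two_ne_zero) ((hfc2 s hs y).differentiableAt two_ne_zero)
    have hRs := h.scalAt_chartRep_eq x hs y
    rw [entropyIntegrand_apply, MetricCoord.conjHeatEntropyDensity_apply,
      MetricCoord.entropyIntegrand_apply, hΔ, hgr, hRs, ← hfrep s y, hn, hurep s y]
  -- (7) the three terms of `□* v` at `(x, t)` read in the chart
  have hΦ0 : chartInv I x ⟨extChartAt I x x, hy₀⟩ = x := extChartAt_to_inv x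
  have hW : ContMDiffOn (I.prod 𝓘(ℝ, ℝ)) 𝓘(ℝ, ℝ) ∞
      (fun p : M × ℝ ↦ entropyIntegrand g cov u n τ₀ p.2 p.1) (univ ×ˢ Icc 0 T') :=
    h.contMDiffOn_conjugateHeatIntegrand hT' hτ₀ hpos hu n
  have hWc : ContDiffOn ℝ ∞ (MetricCoord.conjHeatEntropyDensity (chartRep I g x) uc τ₀ t)
      (extChartAt I x).target := by
    have hGt := hfam.isMetricOn t ht
    have hft := MetricCoord.contDiffOn_of_family hfc ht
    have hut := MetricCoord.contDiffOn_of_family huc_smooth ht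
    have hPt : ContDiffOn ℝ ∞ (MetricCoord.entropyIntegrand (chartRep I g x)
        (MetricCoord.conjHeatPotential uc τ₀) (fun s ↦ τ₀ - s) t) (extChartAt I x).target :=
      ((contDiffOn_const.mul (((contDiffOn_const.mul (hGt.contDiffOn_lapAt hft)).sub
        (hGt.contDiffOn_gradSqAt hft)).add hGt.contDiffOn_scalAt)).add hft).sub contDiffOn_const
    exact hPt.mul hut
  have e0 : ∀ s ∈ Icc 0 T', entropyIntegrand g cov u n τ₀ s x =
      MetricCoord.conjHeatEntropyDensity (chartRep I g x) uc τ₀ s (extChartAt I x x) := by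
    intro s hs
    have h' := hwrep s hs ⟨extChartAt I x x, hy₀⟩
    rwa [hΦ0] at h'
  have e1 : derivWithin (fun s ↦ entropyIntegrand g cov u n τ₀ s x) (Icc 0 T') t =
      MetricCoord.tDerivFun (MetricCoord.conjHeatEntropyDensity (chartRep I g x) uc τ₀)
        (Icc 0 T') t (extChartAt I x x) := by
    rw [MetricCoord.tDerivFun]
    exact derivWithin_congr (fun s hs ↦ e0 s hs) (e0 t ht)
  have e2 : (g t).laplaceBeltrami (entropyIntegrand g cov u n τ₀ t) x =
      MetricCoord.lapAt (chartRep I g x t)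
        (MetricCoord.conjHeatEntropyDensity (chartRep I g x) uc τ₀ t) (extChartAt I x x) := by
    have h' := lapAt_chartRep_eq g x t ⟨extChartAt I x x, hy₀⟩ (hwrep t ht)
      (by rw [hΦ0]; exact ((contMDiff_slice_of_contMDiffOn hW ht) x).of_le h2)
      (MetricCoord.contDiffAt_two_of_contDiffOn hVopen hWc hy₀)
    rw [hΦ0] at h'
    exact h'.symm
  have e3 : (g t).scalarCurvatureWith (cov t) x =
      MetricCoord.scalAt (chartRep I g x t) (extChartAt I x x) := by
    have h' := h.scalAt_chartRep_eq x ht ⟨extChartAt I x x, hy₀⟩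
    rw [hΦ0] at h'
    exact h'.symm
  rw [conjugateHeatOp_apply, e1, e2, e3, e0 t ht]
  linarith [key]

end Pointwise

/-! ### Perelman's no local collapsing theorem from the conjugate heat flow alone -/

/-- **Perelman's no local collapsing theorem I from the backward solvability of `□* u = 0` on
manifolds modelled on `ℝ^m`** (Perelman 2002, §3.1 and §4, Thm. 4.1; Topping 2006, Rem. 8.2.5,
Prop. 8.2.6, Prop. 8.2.1, Thm. 8.3.1). Over all closed manifolds modelled on
`EuclideanSpace ℝ (Fin m)` (all `m`) carrying a Ricci flow of Riemannian metrics `(g, cov)` on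
`[0, T)` and all `0 < t₀ < T`, assume
* `hCH` (**backward solvability of the conjugate heat equation**, Topping Rem. 8.2.5 / (6.4.8);
  standard linear parabolic theory on closed manifolds): every smooth positive `u₁` is the value
  at `t₀` of a positive conjugate heat solution on `M × [0, t₀]` (`IsConjugateHeatSolutionOn`).
Then `perelman_noLocalCollapsing` holds (every model space). The pointwise input (P) of
`perelman_noLocalCollapsing_of_conjugateHeatSolution` is discharged by
`IsRicciFlow.conjugateHeatOp_entropyIntegrand_nonpos` (Topping's Prop. 8.2.6). NOT a discharge of
the named fact: (CH) is not in Mathlib or the tree.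
[cite: Perelman2002, §4, Thm. 4.1] [cite: Topping2006, §8.2, Rem. 8.2.5, Prop. 8.2.6; §8.3, Thm. 8.3.1] -/
theorem perelman_noLocalCollapsing_of_conjugateHeat_existence
    (hCH : ∀ (m : ℕ) {H : Type v} [TopologicalSpace H]
      (I : ModelWithCorners ℝ (EuclideanSpace ℝ (Fin m)) H) [I.Boundaryless]
      (M : Type w) [TopologicalSpace M] [T2Space M] [SecondCountableTopology M] [CompactSpace M]
      [ChartedSpace H M] [IsManifold I ∞ M] [MeasurableSpace M] [BorelSpace M] (T : ℝ), 0 < T →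
      ∀ (g : ℝ → PseudoRiemannianMetric I ∞ (EuclideanSpace ℝ (Fin m)) (TangentSpace I : M → Type _))
        (cov : ℝ → CovariantDerivative I (EuclideanSpace ℝ (Fin m)) (TangentSpace I : M → Type _)),
        IsRicciFlow g cov (Ico 0 T) → (∀ t ∈ Ico 0 T, (g t).IsRiemannian) →
        ∀ t₀ ∈ Ioo 0 T, ∀ u₁ : M → ℝ, ContMDiff I 𝓘(ℝ, ℝ) ∞ u₁ → (∀ x, 0 < u₁ x) →
          ∃ u : ℝ → M → ℝ, u t₀ = u₁ ∧ (∀ t ∈ Icc 0 t₀, ∀ x, 0 < u t x) ∧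
            IsConjugateHeatSolutionOn g cov (Icc 0 t₀) u) :
    perelman_noLocalCollapsing.{u, v, w} :=
  perelman_noLocalCollapsing_of_conjugateHeatSolution hCH
    fun _m _H _ _I _ _M _ _ _ _ _ _ _ _ _T _hT _g _cov hflow hRiem t₀ ht₀ _u hpos hsol τ hτ t ht x ↦
      (hflow.mono fun s hs ↦ ⟨hs.1, hs.2.trans_lt ht₀.2⟩).conjugateHeatOp_entropyIntegrand_nonpos
        ht₀.1 (fun s hs ↦ hRiem s ⟨hs.1, hs.2.trans_lt ht₀.2⟩) hpos hsol finrank_euclideanSpace_fin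
        (by linarith) ht x

end Literature.Geometry.Riemannian

end
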